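import Literature.AlgebraicGeometry.ModuliOfAbelianVarieties.SiegelModuliInterpretation
import Literature.AlgebraicGeometry.ModuliOfAbelianVarieties.SiegelPrincipalLevelFree
import Literature.Geometry.Kaehler.ComplexTorusSiegelNormalForm
import HarnessLib

/-!
# The Siegel torus `ℂ^g/Φ_Z(ℤ^{2g})` versus the torus of a T1′ marking by `[J(Z), r]`, `r ∈ K_δ(1)` (W1, census D16 step 1)

Cell hodgecm-mathlib, rung 0 on `hDel`, W1 (the complex-side witness of `deligne1971_siegelModuliOnPoints` from (F) + (U));
B-p05 census `CENSUS-U-W1-SiegelAnalyticUniformisation` §1 row D16.  The rung-0 fact (U) v0.5 identifies the universal family's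
fibre over the uniformised point `unif_c Z` through a T1′ MARKING `m : SiegelAdelicMarking ⟨J(Z), _⟩ r A₀` of the fibre by the
Shimura-set point `[J(Z), r]` at a principal (hence INTEGRAL) representative `r ∈ K_δ(1)`; W1 must turn that into the field
`exists_isAnalytification_fibre` of ★ `SiegelModuliDatum`, which speaks of the SIEGEL torus `ℂ^g/Φ(ℤ^{2g})` for an arbitrary
presentation `Φ` of `Φ_Z`.  This file supplies the presentation change, carrier-free:

* §1 `siegelPeriodMap_jOfSiegel_mulVec` — `Φ_Z(J_Z x) = i·Φ_Z(x)` (★ `siegelPeriodMatrix_mul_jOfSiegel` on vectors);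
* §2 `IsLatticeBasis.exists_int_of_mem_principalLevelSubgroup_one` — a basis matrix `γ` of `Λ_r` for `r ∈ K_δ(1) = GSp_δ(ẑ)` is
  in `GL_{2g}(ℤ)`: integer matrices `P = γ⁻¹`, `Q = γ` with `PQ = QP = 1` (`Λ_r = ℤ^{2g}`; `ℚ ∩ ẑ = ℤ`, ★
  `exists_int_cast_eq_of_algebraMap_mem_integralAdeles`);
* §3 `SiegelAdelicMarking.exists_homeomorph_siegelTorus` — for a marking `m` by `[J(Z), r]`, `r ∈ K_δ(1)`, and any presentation `Φ`
  of `Φ_Z`: a homeomorphism `ℂ^g/Φ(ℤ^{2g}) ≃ₜ ℂ^g/Ψ_m(ℤ^{2g})`, holomorphic with holomorphic inverse (★ Lange §1.1.2 base change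
  `ComplexTorus.exists_homeomorph_of_baseChange` with integral matrix `γ_m⁻¹` and analytic representation `Ψ_m ∘ γ_m⁻¹ ∘ Φ⁻¹`,
  which is `ℂ`-linear by §1 and the marking's field `Ψ_J`).

Consumer (E-FU day, W1 assembly): `m.isAnalytification.comp_of_isHomeomorph` along §3, then ★ `IsAnalytification.transport_iso`
along «fibre of the marking ≅ fibre of the universal family» ((U3∃) + D4 `classify`).  Theorems only; no carrier, no fact.
HC_CM is proved only modulo the 7 printed citations until rung 0 closes; this file discharges none of them.

## References
* [Lange2023AbelianVarietiesComplex] H. Lange, *Abelian Varieties over the Complex Numbers* (2023), §1.1.2 (Prop. 1.1.8), §7.1.2 (7.3), Lemma 7.1.6.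
* [LangeBirkenhake1992] H. Lange, Ch. Birkenhake, *Complex Abelian Varieties*, §1.1, §8.1.
* [Milne2005ShimuraVarieties] J. S. Milne, *Introduction to Shimura varieties* (2005), §4 pp. 48–49, §6 Thm. 6.11 p. 74, p. 75.
-/

set_option autoImplicit false

noncomputable section

namespace Literature.AlgebraicGeometry.ModuliOfAbelianVarieties

open CategoryTheory Matrix Topology Complex NumberField IsDedekindDomain
open scoped Matrix.Norms.Elementwise Manifold ContDiff
open Literature.AlgebraicGeometry.Motives (AbelianVariety)
open Literature.Geometry.Kaehler (ComplexTorus)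
open Literature.NumberTheory.Automorphic (siegelUpperHalfSpace)
open SiegelModuli (jOfSiegel siegelPeriodMatrix siegelPeriodMap_eq_mulVec siegelPeriodMatrix_mul_jOfSiegel)

variable {g : ℕ} {δ : Fin g → ℕ}

/-- **`Φ_Z(J_Z x) = i · Φ_Z(x)`** — the Siegel period map intertwines the complex structure `J_Z` of `ℝ^{2g}` with
multiplication by `i` on `ℂ^g` (Lange's diagram (7.3), ★ `siegelPeriodMatrix_mul_jOfSiegel`, read on vectors).
[cite: Lange2023AbelianVarietiesComplex, §7.1.2 (7.3) and Lemma 7.1.6 (p0327)] -/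
theorem siegelPeriodMap_jOfSiegel_mulVec (hδ : ∀ i, 0 < δ i) {Z : Matrix (Fin g) (Fin g) ℂ}
    (hZ : Z ∈ siegelUpperHalfSpace g) (x : Fin g ⊕ Fin g → ℝ) :
    siegelPeriodMap δ Z ((jOfSiegel δ Z) *ᵥ x) = Complex.I • siegelPeriodMap δ Z x := by
  have hY : IsUnit (Z.map im).det := (Matrix.isUnit_iff_isUnit_det _).1 hZ.2.isUnit
  rw [siegelPeriodMap_eq_mulVec, siegelPeriodMap_eq_mulVec]
  have hcast : (fun k ↦ (((jOfSiegel δ Z) *ᵥ x) k : ℂ)) =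
      (jOfSiegel δ Z).map ((↑) : ℝ → ℂ) *ᵥ fun k ↦ (x k : ℂ) := by
    funext k
    exact RingHom.map_mulVec Complex.ofRealHom (jOfSiegel δ Z) x k
  rw [hcast, Matrix.mulVec_mulVec, siegelPeriodMatrix_mul_jOfSiegel hδ hY, Matrix.smul_mulVec]

/-- Entries of a matrix congruent to `1` modulo `1·𝓞̂` are integral (helper; = T1′'s private lemma). [folklore] -/
private theorem apply_mem_integralAdeles_of_isCongOne' {M : Matrix (Fin g ⊕ Fin g) (Fin g ⊕ Fin g) finAdeleQ}
    (h : IsCongOne 1 M) (i j : Fin g ⊕ Fin g) : M i j ∈ FiniteAdeleRing.integralAdeles (𝓞 ℚ) ℚ := by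
  have h1 : (1 : Matrix (Fin g ⊕ Fin g) (Fin g ⊕ Fin g) finAdeleQ) i j ∈ FiniteAdeleRing.integralAdeles (𝓞 ℚ) ℚ := by
    rw [Matrix.one_apply]; split_ifs; exacts [one_mem _, zero_mem _]
  have h2 := add_mem (mem_integralAdeles_of_mem_levelIdeal (h i j)) h1
  rw [Matrix.sub_apply, sub_add_cancel] at h2
  exact h2

/-- Products of integral matrices are integral (helper). [folklore] -/
private theorem mul_apply_mem_integralAdeles' {M N : Matrix (Fin g ⊕ Fin g) (Fin g ⊕ Fin g) finAdeleQ}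
    (hM : ∀ i j, M i j ∈ FiniteAdeleRing.integralAdeles (𝓞 ℚ) ℚ)
    (hN : ∀ i j, N i j ∈ FiniteAdeleRing.integralAdeles (𝓞 ℚ) ℚ) (i j : Fin g ⊕ Fin g) :
    (M * N) i j ∈ FiniteAdeleRing.integralAdeles (𝓞 ℚ) ℚ := by
  rw [Matrix.mul_apply]; exact sum_mem fun k _ => mul_mem (hM i k) (hN k j)

/-- **A basis matrix of `Λ_r` for INTEGRAL `r ∈ K_δ(1) = GSp_δ(ℤ̂)` lies in `GL_{2g}(ℤ)`**: both `γ` and `γ⁻¹` have integer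
entries (`Λ_r = ℤ^{2g}`; `γ̂⁻¹ = (γ̂⁻¹ r)·r⁻¹` and `γ̂ = r·(r⁻¹γ̂)` are integral, and `ℚ ∩ ẑ = ℤ`, ★
`exists_int_cast_eq_of_algebraMap_mem_integralAdeles`). [cite: Milne2005ShimuraVarieties, §4 pp. 48–49 and §6 p. 75] -/
theorem IsLatticeBasis.exists_int_of_mem_principalLevelSubgroup_one {r : gspFinAdelic δ}
    (hr : r ∈ principalLevelSubgroup δ 1) {γ : GL (Fin g ⊕ Fin g) ℚ} (hγ : IsLatticeBasis r γ) :
    ∃ P Q : Matrix (Fin g ⊕ Fin g) (Fin g ⊕ Fin g) ℤ,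
      P.map (Int.cast : ℤ → ℚ) = ((γ⁻¹ : GL (Fin g ⊕ Fin g) ℚ) : Matrix (Fin g ⊕ Fin g) (Fin g ⊕ Fin g) ℚ) ∧
      Q.map (Int.cast : ℤ → ℚ) = ((γ : GL (Fin g ⊕ Fin g) ℚ) : Matrix (Fin g ⊕ Fin g) (Fin g ⊕ Fin g) ℚ) ∧
      P * Q = 1 ∧ Q * P = 1 := by
  have hr1 := apply_mem_integralAdeles_of_isCongOne' hr.1
  have hr2 := apply_mem_integralAdeles_of_isCongOne' hr.2
  -- `γ̂⁻¹` and `γ̂` are integral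
  have hinv : ∀ i j, adelicMatrix ((γ⁻¹ : GL (Fin g ⊕ Fin g) ℚ) : Matrix (Fin g ⊕ Fin g) (Fin g ⊕ Fin g) ℚ) i j ∈
      FiniteAdeleRing.integralAdeles (𝓞 ℚ) ℚ := by
    have e : adelicMatrix ((γ⁻¹ : GL (Fin g ⊕ Fin g) ℚ) : Matrix (Fin g ⊕ Fin g) (Fin g ⊕ Fin g) ℚ) =
        (adelicMatrix ((γ⁻¹ : GL (Fin g ⊕ Fin g) ℚ) : Matrix (Fin g ⊕ Fin g) (Fin g ⊕ Fin g) ℚ) *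
          ((r : GL (Fin g ⊕ Fin g) finAdeleQ) : Matrix (Fin g ⊕ Fin g) (Fin g ⊕ Fin g) finAdeleQ)) *
          (((r⁻¹ : gspFinAdelic δ) : GL (Fin g ⊕ Fin g) finAdeleQ) : Matrix (Fin g ⊕ Fin g) (Fin g ⊕ Fin g) finAdeleQ) := by
      rw [Matrix.mul_assoc, Subgroup.coe_inv, ← Units.val_mul, mul_inv_cancel, Units.val_one, Matrix.mul_one]
    intro i j
    rw [e]
    exact mul_apply_mem_integralAdeles' (fun i j => (hγ i j).1) hr2 i j
  have hdir : ∀ i j, adelicMatrix ((γ : GL (Fin g ⊕ Fin g) ℚ) : Matrix (Fin g ⊕ Fin g) (Fin g ⊕ Fin g) ℚ) i j ∈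
      FiniteAdeleRing.integralAdeles (𝓞 ℚ) ℚ := by
    have e : adelicMatrix ((γ : GL (Fin g ⊕ Fin g) ℚ) : Matrix (Fin g ⊕ Fin g) (Fin g ⊕ Fin g) ℚ) =
        ((r : GL (Fin g ⊕ Fin g) finAdeleQ) : Matrix (Fin g ⊕ Fin g) (Fin g ⊕ Fin g) finAdeleQ) *
          ((((r⁻¹ : gspFinAdelic δ) : GL (Fin g ⊕ Fin g) finAdeleQ) : Matrix (Fin g ⊕ Fin g) (Fin g ⊕ Fin g) finAdeleQ) *
            adelicMatrix ((γ : GL (Fin g ⊕ Fin g) ℚ) : Matrix (Fin g ⊕ Fin g) (Fin g ⊕ Fin g) ℚ)) := by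
      rw [← Matrix.mul_assoc, Subgroup.coe_inv, ← Units.val_mul, mul_inv_cancel, Units.val_one, Matrix.one_mul]
    intro i j
    rw [e]
    exact mul_apply_mem_integralAdeles' hr1 (fun i j => (hγ i j).2) i j
  -- integer entries
  have hP : ∀ i j, ∃ z : ℤ, (z : ℚ) = ((γ⁻¹ : GL (Fin g ⊕ Fin g) ℚ) : Matrix (Fin g ⊕ Fin g) (Fin g ⊕ Fin g) ℚ) i j :=
    fun i j => exists_int_cast_eq_of_algebraMap_mem_integralAdeles (by rw [← adelicMatrix_apply]; exact hinv i j)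
  have hQ : ∀ i j, ∃ z : ℤ, (z : ℚ) = ((γ : GL (Fin g ⊕ Fin g) ℚ) : Matrix (Fin g ⊕ Fin g) (Fin g ⊕ Fin g) ℚ) i j :=
    fun i j => exists_int_cast_eq_of_algebraMap_mem_integralAdeles (by rw [← adelicMatrix_apply]; exact hdir i j)
  choose P hP using hP
  choose Q hQ using hQ
  have hPm : (Matrix.of P).map (Int.cast : ℤ → ℚ) = ((γ⁻¹ : GL (Fin g ⊕ Fin g) ℚ) : Matrix (Fin g ⊕ Fin g) (Fin g ⊕ Fin g) ℚ) := by
    ext i j; exact hP i j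
  have hQm : (Matrix.of Q).map (Int.cast : ℤ → ℚ) = ((γ : GL (Fin g ⊕ Fin g) ℚ) : Matrix (Fin g ⊕ Fin g) (Fin g ⊕ Fin g) ℚ) := by
    ext i j; exact hQ i j
  have hinj : Function.Injective (fun M : Matrix (Fin g ⊕ Fin g) (Fin g ⊕ Fin g) ℤ => M.map (Int.cast : ℤ → ℚ)) :=
    Matrix.map_injective Int.cast_injective
  refine ⟨Matrix.of P, Matrix.of Q, hPm, hQm, hinj ?_, hinj ?_⟩
  · change (Matrix.of P * Matrix.of Q).map (Int.castRingHom ℚ) = (1 : Matrix _ _ ℤ).map (Int.castRingHom ℚ)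
    rw [Matrix.map_mul, Matrix.map_one _ (map_zero _) (map_one _)]
    change (Matrix.of P).map (Int.cast : ℤ → ℚ) * (Matrix.of Q).map (Int.cast : ℤ → ℚ) = 1
    rw [hPm, hQm, ← Units.val_mul, inv_mul_cancel, Units.val_one]
  · change (Matrix.of Q * Matrix.of P).map (Int.castRingHom ℚ) = (1 : Matrix _ _ ℤ).map (Int.castRingHom ℚ)
    rw [Matrix.map_mul, Matrix.map_one _ (map_zero _) (map_one _)]
    change (Matrix.of Q).map (Int.cast : ℤ → ℚ) * (Matrix.of P).map (Int.cast : ℤ → ℚ) = 1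
    rw [hPm, hQm, ← Units.val_mul, mul_inv_cancel, Units.val_one]

/-- **THE SIEGEL TORUS IS BIHOLOMORPHIC TO THE TORUS OF ANY MARKING BY `[J(Z), r]`, `r ∈ K_δ(1)`** (D16, step 1): for a T1′
marking `m` of a complex abelian variety by the point `[J(Z), r]` with INTEGRAL `r` and any presentation `Φ` of the Siegel period
isomorphism `Φ_Z`, there is a homeomorphism `e : ℂ^g/Φ(ℤ^{2g}) ≃ ℂ^g/Ψ_m(ℤ^{2g})` holomorphic with holomorphic inverse — the lattice
base change by `γ_m⁻¹ ∈ GL_{2g}(ℤ)` with analytic representation `Ψ_m ∘ γ_m⁻¹ ∘ Φ⁻¹`, which is `ℂ`-LINEAR because both `Φ`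
(★ `siegelPeriodMatrix_mul_jOfSiegel`) and `Ψ_m ∘ γ_m⁻¹` (the field `Ψ_J`) intertwine `J(Z)` with `i` (★ Lange §1.1.2 base change
`ComplexTorus.exists_homeomorph_of_baseChange`). [cite: Lange2023AbelianVarietiesComplex, §1.1.2 (Prop. 1.1.8) and §7.1.2 (7.3)]
[cite: Milne2005ShimuraVarieties, §6 Thm. 6.11 p. 74] -/
theorem SiegelAdelicMarking.exists_homeomorph_siegelTorus (hδ : ∀ i, 0 < δ i) {Z : Matrix (Fin g) (Fin g) ℂ}
    (hZ : Z ∈ siegelUpperHalfSpace g) {hJ : jOfSiegel δ Z ∈ C0pm δ} {r : gspFinAdelic δ}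
    (hr : r ∈ principalLevelSubgroup δ 1) {A : AbelianVariety ℂ} (m : SiegelAdelicMarking ⟨jOfSiegel δ Z, hJ⟩ r A)
    (Φ : (Fin g ⊕ Fin g → ℝ) ≃L[ℝ] (Fin g → ℂ)) (hΦ : ∀ v, Φ v = siegelPeriodMap δ Z v) :
    ∃ e : ComplexTorus Φ ≃ₜ ComplexTorus m.Ψ,
      ContMDiff 𝓘(ℂ, Fin g → ℂ) 𝓘(ℂ, Fin g → ℂ) ω e ∧ ContMDiff 𝓘(ℂ, Fin g → ℂ) 𝓘(ℂ, Fin g → ℂ) ω e.symm := by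
  obtain ⟨P, Q, hP, hQ, hPQ, hQP⟩ := IsLatticeBasis.exists_int_of_mem_principalLevelSubgroup_one hr m.γ_isLatticeBasis
  -- the real matrix of `γ⁻¹` and the real-linear automorphism it defines
  set Gℝ : Matrix (Fin g ⊕ Fin g) (Fin g ⊕ Fin g) ℝ :=
    ((m.γ⁻¹ : GL (Fin g ⊕ Fin g) ℚ) : Matrix (Fin g ⊕ Fin g) (Fin g ⊕ Fin g) ℚ).map (algebraMap ℚ ℝ) with hGℝ
  set Gℝ' : Matrix (Fin g ⊕ Fin g) (Fin g ⊕ Fin g) ℝ :=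
    ((m.γ : GL (Fin g ⊕ Fin g) ℚ) : Matrix (Fin g ⊕ Fin g) (Fin g ⊕ Fin g) ℚ).map (algebraMap ℚ ℝ) with hGℝ'
  have hGG' : Gℝ * Gℝ' = 1 := by
    rw [hGℝ, hGℝ', ← Matrix.map_mul, ← Units.val_mul, inv_mul_cancel, Units.val_one, Matrix.map_one _ (map_zero _) (map_one _)]
  have hG'G : Gℝ' * Gℝ = 1 := by
    rw [hGℝ, hGℝ', ← Matrix.map_mul, ← Units.val_mul, mul_inv_cancel, Units.val_one, Matrix.map_one _ (map_zero _) (map_one _)]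
  let L : (Fin g ⊕ Fin g → ℝ) ≃ₗ[ℝ] (Fin g ⊕ Fin g → ℝ) :=
    LinearEquiv.ofLinear (Matrix.toLin' Gℝ) (Matrix.toLin' Gℝ')
      (by rw [← Matrix.toLin'_mul, hGG', Matrix.toLin'_one])
      (by rw [← Matrix.toLin'_mul, hG'G, Matrix.toLin'_one])
  have hL : ∀ y, L y = Gℝ *ᵥ y := fun y => Matrix.toLin'_apply _ _
  -- the analytic representation `Ψ ∘ γ⁻¹ ∘ Φ⁻¹`
  let Ψlin : (Fin g → ℂ) ≃L[ℝ] (Fin g → ℂ) :=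
    ((Φ.symm.toLinearEquiv.trans L).trans m.Ψ.toLinearEquiv).toContinuousLinearEquiv
  have hΨlin : ∀ x, Ψlin (Φ x) = m.Ψ (Gℝ *ᵥ x) := fun x => by
    change m.Ψ (L (Φ.symm (Φ x))) = _
    rw [ContinuousLinearEquiv.symm_apply_apply, hL]
  -- `P_ℝ = γ⁻¹_ℝ`
  have hcastcomp : (Int.cast : ℤ → ℝ) = (algebraMap ℚ ℝ) ∘ (Int.cast : ℤ → ℚ) :=
    funext fun z => by simp only [Function.comp_apply, eq_ratCast, Rat.cast_intCast]
  have hPℝ : P.map (Int.cast : ℤ → ℝ) = Gℝ := by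
    rw [hGℝ, ← hP, Matrix.map_map, hcastcomp]
  -- `ℂ`-linearity
  have hΨI : ∀ u, Ψlin (Complex.I • u) = Complex.I • Ψlin u := fun u => by
    obtain ⟨x, rfl⟩ := Φ.surjective u
    have hint : Complex.I • Φ x = Φ ((jOfSiegel δ Z) *ᵥ x) := by
      rw [hΦ, hΦ, siegelPeriodMap_jOfSiegel_mulVec hδ hZ]
    rw [hint, hΨlin, hΨlin]
    exact m.Ψ_J x
  obtain ⟨e, -, -, -, he, he'⟩ :=
    Literature.Geometry.Kaehler.ComplexTorus.exists_homeomorph_of_baseChange Φ m.Ψ P Q hPQ hQP Ψlin hΨI fun x => by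
      rw [hPℝ, hΨlin]
  exact ⟨e, he, he'⟩

end Literature.AlgebraicGeometry.ModuliOfAbelianVarieties


end
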